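import Literature.NumberTheory.CubicFields.MaximalCubicRings
import Literature.NumberTheory.CubicFields.StabilizerOneOrThree
import Literature.NumberTheory.CubicFields.ShintaniZeta
import HarnessLib

/-!
# `|Stab| = 3` iff the cubic field is Galois: the weights of the Davenport–Heilbronn orbits (BTT (29))

Topic `Literature/NumberTheory/CubicFields`; built on `MaximalCubicRings.lean` (`R(f) ≅ 𝓞 K_f` for
maximal irreducible `f`), `StabilizerOneOrThree.lean` (`|Aut R(f)| ∣ 3`, `RingAut K_f ≃ (K_f ≃ₐ[ℚ] K_f)`)
and `ShintaniZeta.lean` (`stabCard`, `ringAutCongr`).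

Bhargava–Taniguchi–Thorne 2023, §4.1 (29): "`|Aut(F)| = 1` if `F` is a non-Galois cubic field,
`3` if `F` is a Galois cubic field" — the automorphisms of the cubic field being those of its
maximal order. This file proves, for `f` irreducible and maximal (the Davenport–Heilbronn orbits):

* `RingOfForm.card_ringAut_ringOfIntegers_eq` — `|Aut 𝓞 K| = |Aut K|` for a number field `K`
  (restriction `mapRingEquiv` and extension to the fraction field are mutually inverse injections);
* `RingOfForm.card_ringAut_eq_card_algEquiv_of_isMaximal` — `|Aut R(f)| = |Aut_ℚ K_f|`;
* **`stabCard_eq_three_iff_isGalois`**, **`stabCard_eq_one_iff_not_isGalois`** — `|Stab(f)| = 3`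
  iff `K_f/ℚ` is Galois, `|Stab(f)| = 1` iff it is not.

## References

* M. Bhargava, T. Taniguchi, F. Thorne, *Improved error estimates for the Davenport–Heilbronn
  theorems*, Math. Ann. 389 (2024) = arXiv:2107.12819, §4.1 (29) [BhargavaTaniguchiThorne2023].
-/

namespace Literature.NumberTheory.CubicFields

namespace RingOfForm

open BinaryCubic NumberField

/-! ### `|Aut 𝓞 K| = |Aut K|` -/

section NumberField

variable (K : Type*) [Field K] [NumberField K]

/-- Restriction `Aut K → Aut 𝓞 K` is injective (two automorphisms agreeing on `𝓞 K` agree on its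
fraction field `K`). [folklore] -/
theorem mapRingEquiv_injective : Function.Injective (fun e : RingAut K => RingOfIntegers.mapRingEquiv e) := by
  intro e e' h
  apply RingEquiv.ext
  intro x
  have hh : ∀ y : 𝓞 K, e (algebraMap (𝓞 K) K y) = e' (algebraMap (𝓞 K) K y) := fun y => by
    have := congrArg (fun σ : RingAut (𝓞 K) => ((σ y : 𝓞 K) : K)) h
    simpa [RingOfIntegers.coe_eq_algebraMap] using this
  -- `x = a / b` with `a, b ∈ 𝓞 K`
  obtain ⟨⟨a, b⟩, hx⟩ := IsLocalization.surj (nonZeroDivisors (𝓞 K)) x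
  simp only at hx
  have hb : (algebraMap (𝓞 K) K) b ≠ 0 :=
    IsFractionRing.to_map_ne_zero_of_mem_nonZeroDivisors b.2
  have hx' : x = algebraMap (𝓞 K) K a / algebraMap (𝓞 K) K b := by
    rw [eq_div_iff hb]; exact hx
  rw [hx', map_div₀, map_div₀, hh a, hh b]

/-- Extension `Aut 𝓞 K → Aut K` is injective. [folklore] -/
theorem ringEquivOfRingEquiv_injective :
    Function.Injective (fun σ : RingAut (𝓞 K) => (IsFractionRing.ringEquivOfRingEquiv σ : RingAut K)) := by
  intro σ τ h
  apply RingEquiv.ext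
  intro x
  apply IsFractionRing.injective (𝓞 K) K
  have := congrArg (fun e : RingAut K => e (algebraMap (𝓞 K) K x)) h
  simpa [IsFractionRing.ringEquivOfRingEquiv_algebraMap] using this

/-- **`|Aut 𝓞 K| = |Aut K|`** for a number field `K`. [folklore] -/
theorem card_ringAut_ringOfIntegers_eq : Nat.card (RingAut (𝓞 K)) = Nat.card (RingAut K) := by
  classical
  -- `Aut K` is finite (it injects into the finite `K ≃ₐ[ℚ] K`)
  haveI : Finite (RingAut K) := by
    refine Finite.of_injective (fun e : RingAut K => (AlgEquiv.ofRingEquiv (f := e) (fun q => by simp) : K ≃ₐ[ℚ] K)) ?_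
    intro e e' h
    apply RingEquiv.ext
    intro x
    have := congrArg (fun φ : K ≃ₐ[ℚ] K => φ x) h
    simpa using this
  haveI : Finite (RingAut (𝓞 K)) := Finite.of_injective _ (ringEquivOfRingEquiv_injective K)
  exact le_antisymm (Nat.card_le_card_of_injective _ (ringEquivOfRingEquiv_injective K))
    (Nat.card_le_card_of_injective _ (mapRingEquiv_injective K))

end NumberField

/-! ### Maximal irreducible forms: `|Aut R(f)| = |Aut_ℚ K_f|` -/

variable {f : BinaryCubic ℤ} [hf : Fact f.IsIrreducible]

/-- **`|Aut R(f)| = |Aut_ℚ(K_f)|` for maximal irreducible `f`** (`R(f) ≅ 𝓞 K_f`). [folklore] -/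
theorem card_ringAut_eq_card_algEquiv_of_isMaximal (hmax : IsMaximal f) :
    Nat.card (RingAut (RingOfForm f)) = Nat.card (RatAlgebra f ≃ₐ[ℚ] RatAlgebra f) := by
  rw [Nat.card_congr (ringAutCongr (ringEquivRingOfIntegers hmax)), card_ringAut_ringOfIntegers_eq,
    Nat.card_congr (ringAutEquivAlgEquiv f)]

/-- `|Aut_ℚ K_f| = 3` iff `K_f/ℚ` is Galois. [folklore] -/
theorem card_algEquiv_eq_three_iff_isGalois :
    Nat.card (RatAlgebra f ≃ₐ[ℚ] RatAlgebra f) = 3 ↔ IsGalois ℚ (RatAlgebra f) := by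
  rw [← finrank_ratAlgebra_eq_three (f := f)]
  constructor
  · intro h; exact IsGalois.of_card_aut_eq_finrank ℚ (RatAlgebra f) h
  · intro h; exact IsGalois.card_aut_eq_finrank ℚ (RatAlgebra f)

end RingOfForm

open RingOfForm BinaryCubic

variable {f : BinaryCubic ℤ}

/-- **`|Stab(f)| = 3` iff `K_f` is a Galois cubic field**, for `f` irreducible and maximal (the
Davenport–Heilbronn orbit of the cubic field `K_f`; BTT (29)). [cite: BhargavaTaniguchiThorne2023, §4.1 (29) (|Aut F| = 3 iff F is a Galois cubic field)] -/
theorem stabCard_eq_three_iff_isGalois [hf : Fact f.IsIrreducible] (hmax : IsMaximal f) :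
    stabCard f = 3 ↔ IsGalois ℚ (RatAlgebra f) := by
  rw [stabCard_eq_card_ringAut, card_ringAut_eq_card_algEquiv_of_isMaximal hmax, card_algEquiv_eq_three_iff_isGalois]

/-- **`|Stab(f)| = 1` iff `K_f` is a non-Galois cubic field**, for `f` irreducible and maximal
(BTT (29)). [cite: BhargavaTaniguchiThorne2023, §4.1 (29) (|Aut F| = 1 iff F is a non-Galois cubic field)] -/
theorem stabCard_eq_one_iff_not_isGalois [hf : Fact f.IsIrreducible] (hmax : IsMaximal f) :
    stabCard f = 1 ↔ ¬ IsGalois ℚ (RatAlgebra f) := by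
  rw [← stabCard_eq_three_iff_isGalois hmax]
  have h13 : stabCard f = 1 ∨ stabCard f = 3 := card_stabilizer_eq_one_or_three
  constructor
  · intro h1 h3; omega
  · intro h3; omega

end Literature.NumberTheory.CubicFields
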